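import Literature.AlgebraicGeometry.Frobenioids.Monoids
import Literature.AlgebraicGeometry.Frobenioids.MonoidFunctors
import Literature.AlgebraicGeometry.Frobenioids.ElementaryFrobenioid
import HarnessLib

/-!
# Frobenioids I, §0 / Def. 1.1 (i): the perfection of a divisorial monoid is divisorial

Mochizuki, *The geometry of Frobenioids I*, Kyushu J. Math. **62** (2008), §0 "Monoids" (kurims
p. 11) and Def. 1.1 (i) (p. 19) [cite: MochizukiFrdI2008, §0 p.11].  Elementary facts about the
perfection `M^pf` used tacitly in §2 (Def. 2.4 (i), p. 48: "`M^pf` … [is] also perf-factorial")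
and §4–§5 (passage to perfections):

* `M^pf` is sharp (resp. torsion-free, integral) if `M` is sharp (resp. torsion-free, integral);
  if `M` is divisorial then `M^pf` is saturated, hence divisorial (`IsDivisorial.perfection`);
* a perfect monoid is canonically isomorphic to its perfection (`IsPerfect.equivPerfection`, the
  isomorphism `M → M^pf` of §0 p. 11 packaged as a `MulEquiv`);
* `M^pf` is functorial in isomorphisms (`Perfection.congr`) and `Perfection.map` of an injective
  homomorphism is injective.

Multiplicative notation as in `Monoids.lean`; no statement of the paper is strengthened.
-/

namespace Literature.AlgebraicGeometry.Frobenioids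

open Function

universe u

variable {M : Type u} [CommMonoid M]

namespace Perfection

/-- Every element of `M^pf` has a power in the image of `M`: `(a^{1/k})^{k} = a`, and more
generally `(a^{1/k})^{k j} = a^j`. [cite: MochizukiFrdI2008, §0 p.11] -/
theorem mk_pow_mul_self (a : M) (k : ℕ+) (j : ℕ) : mk a k ^ ((k : ℕ) * j) = of M (a ^ j) := by
  rw [pow_mul, mk_pow_self, map_pow]

/-- `M^pf` is torsion-free if `M` is. [cite: MochizukiFrdI2008, §0 p.11] -/
theorem isTorsionFree (hM : IsTorsionFree M) : IsTorsionFree (Perfection M) := by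
  refine ⟨fun x n hn hx => ?_⟩
  obtain ⟨⟨a, k⟩, rfl⟩ := mk_surjective x
  dsimp only at hx ⊢
  rw [mk_pow, mk_eq_one_iff] at hx
  obtain ⟨N, hN⟩ := hx
  rw [← pow_mul] at hN
  have ha : a = 1 := hM.1 a (n * N) (Nat.mul_pos hn N.pos) hN
  rw [ha, mk_one]

/-- `M^pf` is sharp if `M` is. [cite: MochizukiFrdI2008, §0 p.11] -/
theorem isSharp (hM : IsSharp M) : IsSharp (Perfection M) := by
  refine ⟨fun x hx => ?_⟩
  obtain ⟨y, hy⟩ := hx.exists_right_inv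
  obtain ⟨⟨a, k⟩, rfl⟩ := mk_surjective x
  obtain ⟨⟨b, l⟩, rfl⟩ := mk_surjective y
  dsimp only at hy ⊢
  rw [mk_mul_mk, mk_eq_one_iff] at hy
  obtain ⟨N, hN⟩ := hy
  rw [mul_pow, ← pow_mul] at hN
  have ha : IsUnit (a ^ ((l : ℕ) * (N : ℕ))) := IsUnit.of_mul_eq_one _ hN
  have ha' : a ^ ((l : ℕ) * (N : ℕ)) = 1 := hM.1 _ ha
  rw [hM.isTorsionFree.1 a _ (Nat.mul_pos l.pos N.pos) ha', mk_one]

/-- Right cancellation in `M^pf` on representatives. [cite: MochizukiFrdI2008, §0 p.11] -/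
theorem mk_mul_mk_right_cancel [IsCancelMul M] {a b c : M} {n m p : ℕ+}
    (h : mk a n * mk c p = mk b m * mk c p) : mk a n = mk b m := by
  rw [mk_mul_mk, mk_mul_mk, mk_eq_mk_iff] at h
  obtain ⟨N, hN⟩ := h
  rw [PNat.mul_coe, PNat.mul_coe, mul_pow, mul_pow, ← pow_mul, ← pow_mul, ← pow_mul, ← pow_mul,
    show (m : ℕ) * ((N : ℕ) * ((n : ℕ) * (p : ℕ))) = (n : ℕ) * ((N : ℕ) * ((m : ℕ) * (p : ℕ))) by ring]
    at hN
  have key : a ^ ((p : ℕ) * ((N : ℕ) * ((m : ℕ) * (p : ℕ)))) =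
      b ^ ((p : ℕ) * ((N : ℕ) * ((n : ℕ) * (p : ℕ)))) := mul_right_cancel hN
  refine mk_eq_mk_iff.mpr ⟨N * p * p, ?_⟩
  rw [PNat.mul_coe, PNat.mul_coe]
  convert key using 2 <;> ring

/-- `M^pf` is cancellative if `M` is. [cite: MochizukiFrdI2008, §0 p.11] -/
theorem isCancelMul [IsCancelMul M] : IsCancelMul (Perfection M) where
  mul_left_cancel z := by
    intro x y h
    obtain ⟨⟨a, n⟩, rfl⟩ := mk_surjective x
    obtain ⟨⟨b, m⟩, rfl⟩ := mk_surjective y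
    obtain ⟨⟨c, p⟩, rfl⟩ := mk_surjective z
    have h' : mk a n * mk c p = mk b m * mk c p := by
      rw [mul_comm (mk a n), mul_comm (mk b m)]
      exact h
    exact mk_mul_mk_right_cancel h'
  mul_right_cancel z := by
    intro x y h
    obtain ⟨⟨a, n⟩, rfl⟩ := mk_surjective x
    obtain ⟨⟨b, m⟩, rfl⟩ := mk_surjective y
    obtain ⟨⟨c, p⟩, rfl⟩ := mk_surjective z
    exact mk_mul_mk_right_cancel h

/-- `M^pf` is integral if `M` is. [cite: MochizukiFrdI2008, §0 p.11] -/
theorem isIntegral (hM : IsIntegral M) : IsIntegral (Perfection M) := by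
  haveI : IsCancelMul M := isIntegral_iff_isCancelMul.mp hM
  exact isIntegral_iff_isCancelMul.mpr isCancelMul

/-- `M^pf` is of characteristic type if `M` is sharp (its units are then trivial).
[cite: MochizukiFrdI2008, §0 p.11] -/
theorem isOfCharType (hM : IsSharp M) : IsOfCharType (Perfection M) :=
  ⟨fun u _ _ => Units.ext ((isSharp hM).1 _ u.isUnit)⟩

/-- The `n`-th power maps of `M^pf` are injective (`M^pf` is perfect). [cite: MochizukiFrdI2008, §0 p.11] -/
theorem pow_injective {n : ℕ} (hn : 0 < n) : Injective fun x : Perfection M => x ^ n :=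
  (isPerfect_perfection.1 n hn).1

/-- Every element of `M^gp` is a quotient of two elements of `M`. [folklore] -/
private theorem gp_exists_eq_div' {N : Type u} [CommMonoid N] (x : Algebra.GrothendieckGroup N) :
    ∃ a b : N, x = Algebra.GrothendieckGroup.of a / Algebra.GrothendieckGroup.of b := by
  obtain ⟨⟨a, b⟩, h⟩ := (Localization.monoidOf (⊤ : Submonoid N)).surj x
  exact ⟨a, b, eq_div_iff_mul_eq'.mpr h⟩

/-- **`M^pf` is saturated if `M` is divisorial** (§0 p. 11 / Def. 1.1 (i)): if `x ∈ (M^pf)^gp` has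
`x^n ∈ M^pf`, raise to a power landing in `M`, saturate there, and take the root in the perfect
monoid `M^pf`. [cite: MochizukiFrdI2008, §0 p.11] -/
theorem isSaturated (hM : IsDivisorial M) : IsSaturated (Perfection M) := by
  haveI : IsCancelMul M := isIntegral_iff_isCancelMul.mp hM.isPreDivisorial.isIntegral
  have hofM : Injective (of M) := of_injective_of_isSharp_isIntegral_isSaturated hM.isSharp
    hM.isPreDivisorial.isIntegral hM.isPreDivisorial.isSaturated
  have hofP : Injective (Algebra.GrothendieckGroup.of (M := Perfection M)) :=
    (isIntegral hM.isPreDivisorial.isIntegral).1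
  have hgofM : Injective (Algebra.GrothendieckGroup.of (M := M)) := hM.isPreDivisorial.isIntegral.1
  refine ⟨fun x n hn ⟨w, hw⟩ => ?_⟩
  obtain ⟨u, v, rfl⟩ := gp_exists_eq_div' x
  -- `u ^ n = w * v ^ n` in `M^pf`
  have h1 : u ^ n = w * v ^ n := hofP (by
    rw [map_mul, map_pow, map_pow, hw, div_pow, div_mul_cancel])
  obtain ⟨⟨a, k⟩, rfl⟩ := mk_surjective u
  obtain ⟨⟨b, l⟩, rfl⟩ := mk_surjective v
  obtain ⟨⟨c, m⟩, rfl⟩ := mk_surjective w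
  dsimp only at h1 ⊢
  -- a common exponent `K = k l m` taking `u, v, w` into `M`
  let K : ℕ+ := k * (l * m)
  have hK : (K : ℕ) = (k : ℕ) * ((l : ℕ) * (m : ℕ)) := by simp [K, PNat.mul_coe]
  have hu : mk a k ^ (K : ℕ) = of M (a ^ ((l : ℕ) * (m : ℕ))) := by
    rw [hK]
    exact mk_pow_mul_self a k _
  have hv : mk b l ^ (K : ℕ) = of M (b ^ ((k : ℕ) * (m : ℕ))) := by
    rw [hK, show (k : ℕ) * ((l : ℕ) * (m : ℕ)) = (l : ℕ) * ((k : ℕ) * (m : ℕ)) by ring]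
    exact mk_pow_mul_self b l _
  have hw' : mk c m ^ (K : ℕ) = of M (c ^ ((k : ℕ) * (l : ℕ))) := by
    rw [hK, show (k : ℕ) * ((l : ℕ) * (m : ℕ)) = (m : ℕ) * ((k : ℕ) * (l : ℕ)) by ring]
    exact mk_pow_mul_self c m _
  generalize a ^ ((l : ℕ) * (m : ℕ)) = a' at hu
  generalize b ^ ((k : ℕ) * (m : ℕ)) = b' at hv
  generalize c ^ ((k : ℕ) * (l : ℕ)) = c' at hw'
  -- in `M`: `a'^n = c' * b'^n`
  have h2 : a' ^ n = c' * b' ^ n := hofM (by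
    have e1 : of M (a' ^ n) = (mk a k ^ (K : ℕ)) ^ n := by rw [map_pow, hu]
    have e2 : of M (c' * b' ^ n) = mk c m ^ (K : ℕ) * (mk b l ^ (K : ℕ)) ^ n := by
      rw [map_mul, ← hw', map_pow, ← hv]
    rw [e1, e2, ← pow_mul, mul_comm (K : ℕ) n, pow_mul, h1, mul_pow, ← pow_mul, ← pow_mul,
      mul_comm n (K : ℕ)])
  -- saturation in `M`: `a' = d * b'`
  have h3 : (Algebra.GrothendieckGroup.of a' / Algebra.GrothendieckGroup.of b') ^ n ∈
      Set.range (Algebra.GrothendieckGroup.of (M := M)) :=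
    ⟨c', by rw [div_pow, ← map_pow, ← map_pow, h2, map_mul, mul_div_cancel_right]⟩
  obtain ⟨d, hd⟩ := hM.isPreDivisorial.isSaturated.1 _ n hn h3
  have h4 : a' = d * b' := hgofM (by rw [map_mul, hd, div_mul_cancel])
  -- root in `M^pf`: `u = d^{1/K} * v`
  have h5 : mk a k = mk d K * mk b l := by
    apply pow_injective (n := (K : ℕ)) K.pos
    dsimp only
    rw [mul_pow, hu, hv, h4, map_mul, mk_pow_self]
  refine ⟨mk d K, ?_⟩
  rw [h5, map_mul, mul_div_cancel_right]

end Perfection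

/-- **The perfection of a divisorial monoid is divisorial** (Def. 1.1 (i); used for "`M^pf` is
perf-factorial", Def. 2.4 (i) p. 48). [cite: MochizukiFrdI2008, Def. 1.1(i) p.19] -/
theorem IsDivisorial.perfection (hM : IsDivisorial M) : IsDivisorial (Perfection M) where
  isPreDivisorial :=
    { isIntegral := Perfection.isIntegral hM.isPreDivisorial.isIntegral
      isSaturated := Perfection.isSaturated hM
      isOfCharType := Perfection.isOfCharType hM.isSharp }
  isSharp := Perfection.isSharp hM.isSharp

/-! ### Perfect monoids are their own perfection -/

/-- "`M` is perfect if and only if `M → M^pf` is an isomorphism" (§0 p. 11): for perfect `N`, the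
natural map packaged as an isomorphism `N ≅ N^pf`. [cite: MochizukiFrdI2008, §0 p.11] -/
noncomputable def IsPerfect.equivPerfection {N : Type u} [CommMonoid N] (h : IsPerfect N) :
    N ≃* Perfection N :=
  MulEquiv.ofBijective (Perfection.of N) (isPerfect_iff_bijective_of.mp h)

/-- `equivPerfection` is the natural map `N → N^pf`. [cite: MochizukiFrdI2008, §0 p.11] -/
@[simp] theorem IsPerfect.equivPerfection_apply {N : Type u} [CommMonoid N] (h : IsPerfect N)
    (a : N) : h.equivPerfection a = Perfection.of N a := rfl

/-! ### Functoriality in isomorphisms; injectivity -/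

namespace Perfection

variable {N N' : Type u} [CommMonoid N] [CommMonoid N']

/-- `Perfection.map` of an injective homomorphism is injective. [cite: MochizukiFrdI2008, §0 p.11] -/
theorem map_injective (f : N →* N') (hf : Injective f) : Injective (map f) := by
  intro x y hxy
  obtain ⟨⟨a, n⟩, rfl⟩ := mk_surjective x
  obtain ⟨⟨b, m⟩, rfl⟩ := mk_surjective y
  dsimp only at hxy ⊢
  rw [map_mk, map_mk, mk_eq_mk_iff] at hxy
  obtain ⟨K, hK⟩ := hxy
  rw [← map_pow, ← map_pow] at hK
  exact mk_eq_mk_iff.mpr ⟨K, hf hK⟩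

/-- `M^pf` is functorial in isomorphisms: `N ≅ N'` induces `N^pf ≅ N'^pf`. [cite: MochizukiFrdI2008, §0 p.11] -/
def congr (e : N ≃* N') : Perfection N ≃* Perfection N' where
  toFun := map (e : N →* N')
  invFun := map (e.symm : N' →* N)
  left_inv x := by
    have h := DFunLike.congr_fun (map_comp (e : N →* N') (e.symm : N' →* N)).symm x
    rw [MonoidHom.comp_apply] at h
    rw [h, show (e.symm : N' →* N).comp (e : N →* N') = MonoidHom.id N from
      MonoidHom.ext fun a => e.symm_apply_apply a, map_id, MonoidHom.id_apply]
  right_inv y := by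
    have h := DFunLike.congr_fun (map_comp (e.symm : N' →* N) (e : N →* N')).symm y
    rw [MonoidHom.comp_apply] at h
    rw [h, show (e : N →* N').comp (e.symm : N' →* N) = MonoidHom.id N' from
      MonoidHom.ext fun a => e.apply_symm_apply a, map_id, MonoidHom.id_apply]
  map_mul' x y := map_mul _ x y

/-- `Perfection.congr e` on classes. [cite: MochizukiFrdI2008, §0 p.11] -/
@[simp] theorem congr_mk (e : N ≃* N') (a : N) (n : ℕ+) : congr e (mk a n) = mk (e a) n := rfl

/-- `Perfection.congr e (of a) = of (e a)`. [cite: MochizukiFrdI2008, §0 p.11] -/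
@[simp] theorem congr_of (e : N ≃* N') (a : N) : congr e (of N a) = of N' (e a) := rfl

end Perfection

end Literature.AlgebraicGeometry.Frobenioids
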